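import Summits.AtomisticToContinuum.HydrodynamicLimit.Theses.InformationPercolationEngine
import Literature.MathematicalPhysics.KineticTheory.TaggedSphereSpectralGap
import Summits.AtomisticToContinuum.HydrodynamicLimit.Theorems.SpectralContractionR.Negative.WithoutMeanZero
import Summits.AtomisticToContinuum.HydrodynamicLimit.Theorems.InformationPercolationEngineSpectralContractionRNormSq
import Summits.AtomisticToContinuum.HydrodynamicLimit.Theorems.InformationPercolationEngineSpectralContractionRGainOpRep
import Summits.AtomisticToContinuum.HydrodynamicLimit.Theorems.InformationPercolationEngineSpectralContractionRNegType
import Summits.AtomisticToContinuum.HydrodynamicLimit.Theorems.InformationPercolationEngineSpectralContractionRFluxPair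
import Summits.AtomisticToContinuum.HydrodynamicLimit.Theorems.InformationPercolationEngineSpectralContractionRPartnerLaw
import Summits.AtomisticToContinuum.HydrodynamicLimit.Theorems.InformationPercolationEngineSpectralContractionRCoreBound

/-!
# Line `Sketch` (driven as the swap-symmetrisation / negative-type line) for the crux
# `InformationPercolationEngine.SpectralContractionR` (stmt-AtomisticToContinuum-13913)

Crux: `∃ c < 1/2, ∀ f measurable, ∫ f² νM < ∞, ∫ f νM = 0 → ∫ (K f)² νM ≤ c ∫ f² νM`, `M` the standard
Maxwellian on `ℝ³`, `ν = a₁` the hard-sphere collision frequency, `K f = ν⁻¹ K⁺ f` the one-collision (gain)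
average of a tagged sphere in the Maxwellian bath. We prove it with `c = 1/4`.

## The lever
On `Ω = ℝ³ × ℝ³ × S²` with the (unnormalised) flux measure `dμ = ((v-w)·ω)₊ M(v) M(w) dv dw dσ(ω)` put
`h = f(v) + f(w)` and `h' = f(v') + f(w')`, `(v', w') = collide ω (v, w)`.
* ISOTROPY (`stub_partnerLaw`): for fixed `(v, w)` the laws of `v'` and of `w'` under `((v-w)·ω)₊ dσ(ω)`
  coincide (hard-sphere CM scattering: `v', w' = (v+w)/2 ± |v-w| R_ω q̂ /2` and the law of `R_ω q̂` is
  antipodally symmetric — Archimedes' hat-box in flux form, `lintegral_toSphere_cos_comp_coords`, plus a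
  measure-preserving involution of the unit disc). Hence `E_μ[f(v) f(w')] = E_μ[f(v) f(v')] = Q(f, f)`
  (`Q = carlemanForm 1`), and with the swap symmetry `(v, w, ω) ↦ (w, v, -ω)`: `E_μ[h h'] = 4 Q(f, f)`.
* CONTRACTION (`stub_coreBound`): `|E_μ[h h']| ≤ ½ E_μ[h²] + ½ E_μ[h'²] = E_μ[h²] = 2 N(f) + 2 W(f)` by the
  measure-preserving collision involution (`measurePreserving_collideSwap_prod`), where
  `N(f) = ∫ f² a₁ M` and `W(f) = E_μ[f(v) f(w)] = ∫∫ ν(v-w) M(v) f(v) M(w) f(w)` (flux pair correlation).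
  So `|Q(f,f)| ≤ ½ (N(f) + W(f))`.
* NEGATIVE TYPE (`stub_negType`, `stub_fluxPairNonpos`): `∫∫ ν(v-w) φ(v) φ(w) ≤ 0` whenever `∫ φ = 0`
  (slice `((v-w)·ω)₊ = ∫ 1{w·ω < r < v·ω} dr` along each `ω`: the form is `-∫∫ F_ω(r)² dr dσ`), transported
  from the hyperplane `∫ φ = 0` to the π-centred hyperplane `∫ f a₁ M = 0` (`φ = fM - (∫ fM) M`,
  `∫∫ ν(v-w) f M (v) M(w) = ∫ f a₁ M = 0`): `W(f) ≤ 0`. Hence `|Q(f, f)| ≤ ½ N(f)` on `1^⊥`.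
* OPERATOR STEP (`stub_normSqLeQuarter`, abstract): on BGSR's Hilbert space `L²(a₁ M)` the gain operator
  `T = gainOp` is self-adjoint with `⟪T x, 1⟫ = ⟪x, 1⟫`; `|⟪T x, x⟫| ≤ ½‖x‖²` on `1^⊥` gives, by
  polarisation with `x ± 2 T x ∈ 1^⊥`, `‖T x‖² ≤ ¼ ‖x‖²`.
* DICTIONARY (`stub_gainOpRep`): `rep (T (toLp f)) = a₁⁻¹ K⁺ f` a.e. (Carleman form), and the crux's typed
  `K f v = a₁(v)⁻¹ linearBoltzmannGain 1 f v = a₁(v)⁻¹ carlemanGain 1 f v` for a.e. `v`.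

## Disproof used (`Cruxes/SpectralContractionR/Disproof.lean`, cdisprove: NO KILL, c = 1/4 line validated)
`_false_without_meanZero` — mean-zero enters exactly at `stub_fluxPairNonpos`; `_false_without_measurable` —
measurability enters through Fubini/Carleman (`FiniteEnergy`); `_false_without_integrable` — finite energy is a
hypothesis of every analytic stub; strengthening `c ≤ 1/5` refuted — we claim `c = 1/4` only. No stub is an
instance of a landed `Negative/*` lemma.
-/

noncomputable section

open MeasureTheory Metric Real Set Filter Topology
open scoped InnerProductSpace ENNReal

namespace Summit.AtomisticToContinuum.HydrodynamicLimit.Cruxes.SpectralContractionR.SwapSymmetrisation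

open Literature.MathematicalPhysics.KineticTheory
open Literature.Analysis.FunctionSpaces (maxwellianBeta maxwellianBeta_one maxwellianBeta_pos)
open Literature.Analysis.FluidPDE (globalMaxwellian)
open TaggedSphereDiffusion (collisionFrequency)
open Summit.AtomisticToContinuum.HydrodynamicLimit.Theses.InformationPercolationEngine (SpectralContractionR)

open Summit.AtomisticToContinuum.HydrodynamicLimit.Theorems.SpectralContractionRLine.GainOpRep (hd3)

/-! ## Registered stubs (`Holds.stub_*`; all six discharged by the landed `Theorems/…SpectralContractionR<Stub>.lean` files) -/

namespace Holds

/-- STUB A (ISOTROPY OF HARD-SPHERE SCATTERING — the partner law equals the tagged law; size M).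
For fixed incoming velocities `(v, w)`, under the flux weight `((v-w)·ω)₊ dσ(ω)` the outgoing partner
velocity `w' = (collide ω (v,w)).2` and the outgoing tagged velocity `v' = (collide ω (v,w)).1` have the
SAME law on `ℝ³`. Geometry: `v' = P/2 + (|q|/2) R_ω q̂`, `w' = P/2 - (|q|/2) R_ω q̂` (`P = v+w`, `q = v-w`,
`R_ω x = x - 2⟪x,ω⟫ω`), so it is the antipodal symmetry of the law of `R_ω q̂` under `⟪q̂,ω⟫₊ dσ(ω)`.
Route: Archimedes' hat-box in flux form `Literature.Analysis.FluidPDE.lintegral_toSphere_cos_comp_coords`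
(`∫ ⟪a,ω⟫₊ F(coords a ω) dσ = ∫_{|p|<1} F p dp`, with `Lambert.lift_coords`: `ω = lift a (coords a ω)` on
the hemisphere) turns both sides into integrals over the unit disc of `ℝ²`; there
`R_{lift a p} a = (2|p|²-1) a - 2√(1-|p|²) embed a p`, and the disc involution
`β p = -√(1-|p|²) p/|p|` (polar coordinates `(r,θ) ↦ (√(1-r²), θ+π)`, Lebesgue-measure preserving on the
disc: `lintegral_comp_polarCoord_symm` + the 1-D substitution `u = r²`) satisfies
`R_{lift a (β p)} a = - R_{lift a p} a`. [folklore] -/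
theorem stub_partnerLaw : ∀ v w : V3,
    (sphereMeasure.withDensity (fun ω => ENNReal.ofReal (hardSphereKernel (v, w) ω))).map
        (fun ω => (collide ω (v, w)).2) =
      (sphereMeasure.withDensity (fun ω => ENNReal.ofReal (hardSphereKernel (v, w) ω))).map
        (fun ω => (collide ω (v, w)).1) := by
  exact Summit.AtomisticToContinuum.HydrodynamicLimit.Theorems.SpectralContractionRLine.PartnerLaw.stub_partnerLaw

/-- STUB B (NEGATIVE TYPE OF THE FLUX KERNEL, sliced form; size M). For an integrable `φ : ℝ³ → ℝ` with
finite first moment and TOTAL MASS ZERO, `∫∫ ν(v - w) φ(v) φ(w) dv dw ≤ 0`, where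
`ν(v-w) = ∫ ((v-w)·ω)₊ dσ(ω)` (`= integral_hardSphereKernel = lorentzLossRate (v-w) = π|v-w|`).
Route: Fubini to put `dσ(ω)` outside (`|((v-w)·ω)₊| ≤ |v|+|w|`); for fixed `ω`,
`((v-w)·ω)₊ = ∫ 1{⟪w,ω⟫ < r} 1{r < ⟪v,ω⟫} dr`, so the double integral is
`∫ F(r) G(r) dr` with `F(r) = ∫_{⟪v,ω⟫ > r} φ`, `G(r) = ∫_{⟪w,ω⟫ < r} φ = -∫_{⟪w,ω⟫ ≥ r} φ = -F(r)`
(mass zero; hyperplanes are Lebesgue-null, `Measure.addHaar_submodule`), i.e. `-∫ F² ≤ 0`. [folklore] -/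
theorem stub_negType : ∀ φ : V3 → ℝ, Integrable φ → Integrable (fun v => ‖v‖ * φ v) →
    ∫ v, φ v = 0 →
    ∫ v, ∫ w, (∫ ω, hardSphereKernel (v, w) ω ∂sphereMeasure) * (φ v * φ w) ≤ 0 := by
  exact Summit.AtomisticToContinuum.HydrodynamicLimit.Theorems.SpectralContractionRLine.NegType.stub_negType

/-- STUB C (THE FLUX PAIR CORRELATION IS NONPOSITIVE ON THE π-CENTRED HYPERPLANE; size M). Given
negative type on `{∫ φ = 0}` (the hypothesis = STUB B verbatim), for `g` of finite `a₁M`-energy with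
`∫ g a₁ M = 0`: `W(g) = ∫∫ ν(v-w) (M g)(v) (M g)(w) ≤ 0`. Route (pivot 2 of Disproof.lean,
`bilin_nonpos_of_orthogonal`, made concrete): `φ = gM - m M`, `m = ∫ gM` (`integral_maxwellianBeta`: `∫ M = 1`),
has mass zero and finite first moment (`a₁(v) ≥ c|v|`, `collisionFrequency_ge_const_mul_norm`, so
`|v| g² M ≤ c⁻¹ g² a₁ M`); expand the form bilinearly: the cross term is
`∫ gM (v) ∫ ν(v-w) M(w) dw = ∫ g a₁ M = 0` (`collisionFrequency_eq`, symmetry of `ν(v-w)` via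
`lorentzLossRate_eq_norm_mul`), the `M`-`M` term is `m² ∫ a₁ M ≥ 0`; hence `W(g) ≤ -m² ∫ a₁M ≤ 0`. [folklore] -/
theorem stub_fluxPairNonpos :
    (∀ φ : V3 → ℝ, Integrable φ → Integrable (fun v => ‖v‖ * φ v) → ∫ v, φ v = 0 →
      ∫ v, ∫ w, (∫ ω, hardSphereKernel (v, w) ω ∂sphereMeasure) * (φ v * φ w) ≤ 0) →
    ∀ g : V3 → ℝ, FiniteEnergy 1 g →
      ∫ v, g v * (collisionFrequency 1 v * maxwellianBeta 1 v) = 0 →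
      ∫ v, ∫ w, (∫ ω, hardSphereKernel (v, w) ω ∂sphereMeasure) *
          ((maxwellianBeta 1 v * g v) * (maxwellianBeta 1 w * g w)) ≤ 0 := by
  exact Summit.AtomisticToContinuum.HydrodynamicLimit.Theorems.SpectralContractionRLine.FluxPair.stub_fluxPairNonpos

/-- STUB D (CORE FORM BOUND by swap-symmetrisation; size L; the lead's). Given isotropy (the hypothesis =
STUB A verbatim), for `g` of finite energy: `|Q(g,g)| ≤ ½ (N(g) + W(g))`, `Q = carlemanForm 1`
(`= E_μ[g(v) g(v')]` by `carlemanForm_eq_integral_carlemanGain` + `linearBoltzmannGain_eq_carlemanGain`),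
`N(g) = ∫ g² a₁ M = E_μ[g(v)²]`, `W(g) = E_μ[g(v) g(w)]`. Route: on `Ω = (ℝ³ × ℝ³) × S²` with
`dμ = ((v-w)·ω)₊ M(v)M(w) dλ`, `h = g(v) + g(w)`, `h' = g(v') + g(w')`: `E[h h'] = 4Q` (two swap
symmetries `measurePreserving_swap_negDir` + isotropy for `E[g(v)g(w')] = E[g(v)g(v')]`), and
`|E[h h']| ≤ ½E[h²] + ½E[h'²] = E[h²] = 2N + 2W` (`μ` is invariant under the collision involution
`measurePreserving_collideSwap_prod`: kernel and `M(v)M(w)` are conserved). [folklore] -/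
theorem stub_coreBound :
    (∀ v w : V3,
      (sphereMeasure.withDensity (fun ω => ENNReal.ofReal (hardSphereKernel (v, w) ω))).map
          (fun ω => (collide ω (v, w)).2) =
        (sphereMeasure.withDensity (fun ω => ENNReal.ofReal (hardSphereKernel (v, w) ω))).map
          (fun ω => (collide ω (v, w)).1)) →
    ∀ g : V3 → ℝ, FiniteEnergy 1 g →
      |carlemanForm 1 g g| ≤ (1 / 2) *
        ((∫ v, g v ^ 2 * (collisionFrequency 1 v * maxwellianBeta 1 v)) +
          ∫ v, ∫ w, (∫ ω, hardSphereKernel (v, w) ω ∂sphereMeasure) *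
            ((maxwellianBeta 1 v * g v) * (maxwellianBeta 1 w * g w))) := by
  exact Summit.AtomisticToContinuum.HydrodynamicLimit.Theorems.SpectralContractionRLine.CoreBound.stub_coreBound

/-- STUB E (DICTIONARY: the Riesz-defined gain operator acts pointwise as `a₁⁻¹ K⁺`; size M). For `f` of
finite energy, a representative of `gainOp (toLp f) ∈ L²(a₁ M)` is `v ↦ a₁(v)⁻¹ ∫ k₁(v,u) f(v+u) du` a.e.
Route (the template is `ae_sub_carlemanGain_eq_of` in `TaggedSphereDiffusionCorrector`): test against
indicators `1_S ∈ L²` — `⟪T (toLp f), 1_S⟫ = carlemanForm 1 f 1_S = ∫_S (carlemanGain 1 f) M`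
(`inner_gainOp`, `truncForm_congr_ae`, `carlemanForm_eq_integral_carlemanGain`) and
`⟪T (toLp f), 1_S⟫ = ∫_S rep (T (toLp f)) a₁ M` (`inner_eq_integral_rep`); both densities are integrable
(`integrable_carlemanGain_mul_maxwellianBeta`), so they agree a.e. (`ae_eq_zero_of_forall_setIntegral_eq_zero`)
and `a₁ M > 0`. [folklore] -/
theorem stub_gainOpRep : ∀ (f : V3 → ℝ) (hf : FiniteEnergy 1 f),
    rep (gainOp hd3 one_pos ((hf.memLp one_pos).toLp f)) =ᵐ[volume]
      fun v => (collisionFrequency 1 v)⁻¹ * carlemanGain 1 f v := by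
  exact Summit.AtomisticToContinuum.HydrodynamicLimit.Theorems.SpectralContractionRLine.GainOpRep.stub_gainOpRep

/-- STUB F (OPERATOR STEP: numerical radius `½` on `1^⊥` ⇒ norm `½` on `1^⊥`; size S, pure algebra). For a
bounded self-adjoint `T` on a real inner product space with `⟪T x, e⟫ = ⟪x, e⟫` and
`|⟪T x, x⟫| ≤ ½‖x‖²` on `e^⊥`: `‖T x‖² ≤ ¼‖x‖²` on `e^⊥`. Route: `y = T x ∈ e^⊥`;
`⟪T(x+ty), x+ty⟫ - ⟪T(x-ty), x-ty⟫ = 4t ‖y‖² ≤ ½(‖x+ty‖² + ‖x-ty‖²) = ‖x‖² + t²‖y‖²`; take `t = 2`. [folklore] -/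
theorem stub_normSqLeQuarter : ∀ (H : Type) [NormedAddCommGroup H] [InnerProductSpace ℝ H]
    (T : H →L[ℝ] H) (e : H),
    (∀ x y : H, ⟪T x, y⟫_ℝ = ⟪x, T y⟫_ℝ) → (∀ x : H, ⟪T x, e⟫_ℝ = ⟪x, e⟫_ℝ) →
    (∀ x : H, ⟪x, e⟫_ℝ = 0 → |⟪T x, x⟫_ℝ| ≤ (1 / 2) * ‖x‖ ^ 2) →
    ∀ x : H, ⟪x, e⟫_ℝ = 0 → ‖T x‖ ^ 2 ≤ (1 / 4) * ‖x‖ ^ 2 := by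
  exact Summit.AtomisticToContinuum.HydrodynamicLimit.Theorems.SpectralContractionRLine.NormSq.stub_normSqLeQuarter

end Holds

/-! ## Composition: the six stubs ⟹ the crux BY NAME -/

open Summit.AtomisticToContinuum.HydrodynamicLimit.Theorems.SpectralContractionRWithoutMeanZero (nu_eq) in
/-- **The skeleton theorem**: isotropy, negative type, its π-centred transport, the core form bound, the
dictionary and the operator step give `SpectralContractionR` with `c = 1/4`. -/
theorem SpectralContractionR_of
    (HA : type_of% Holds.stub_partnerLaw) (HB : type_of% Holds.stub_negType)
    (HC : type_of% Holds.stub_fluxPairNonpos) (HD : type_of% Holds.stub_coreBound)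
    (HE : type_of% Holds.stub_gainOpRep) (HF : type_of% Holds.stub_normSqLeQuarter) : SpectralContractionR := by
  -- the operator on BGSR's Hilbert space `L²(a₁ M)`
  set T := gainOp (d := Fin 3) hd3 one_pos with hT
  set e := constOne (d := Fin 3) (β := (1 : ℝ)) one_pos with he
  -- Step 1: the numerical-radius bound `|⟪T x, x⟫| ≤ ½‖x‖²` on `1^⊥`
  have core : ∀ x : Lp ℝ 2 (energyMeasure (d := Fin 3) 1), ⟪x, e⟫_ℝ = 0 →
      |⟪T x, x⟫_ℝ| ≤ (1 / 2) * ‖x‖ ^ 2 := by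
    intro x hx
    have hg : FiniteEnergy 1 (rep x) := finiteEnergy_rep one_pos x
    have hmean : ∫ v, rep x v * (collisionFrequency 1 v * maxwellianBeta 1 v) = 0 := by
      rw [← inner_constOne hd3 one_pos x]; exact hx
    have h1 := HD HA (rep x) hg
    have h2 := HC HB (rep x) hg hmean
    have h3 : ‖x‖ ^ 2 = ∫ v, rep x v ^ 2 * (collisionFrequency 1 v * maxwellianBeta 1 v) := by
      rw [norm_sq_eq_integral_rep one_pos]
      refine integral_congr_ae (Eventually.of_forall fun v => ?_)
      simp only; ring
    rw [hT, inner_gainOp, h3]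
    have h4 : |carlemanForm 1 (rep x) (rep x)| ≤
        (1 / 2) * ∫ v, rep x v ^ 2 * (collisionFrequency 1 v * maxwellianBeta 1 v) := by
      linarith
    exact h4
  -- Step 2: the operator step `‖T x‖² ≤ ¼‖x‖²` on `1^⊥`
  have quarter : ∀ x : Lp ℝ 2 (energyMeasure (d := Fin 3) 1), ⟪x, e⟫_ℝ = 0 →
      ‖T x‖ ^ 2 ≤ (1 / 4) * ‖x‖ ^ 2 :=
    HF (Lp ℝ 2 (energyMeasure (d := Fin 3) 1)) T e (inner_gainOp_comm hd3 one_pos)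
      (inner_gainOp_constOne hd3 one_pos) core
  -- Step 3: the crux, through the dictionary
  refine ⟨1 / 4, by norm_num, ?_⟩
  intro M S ν K f hf hint hmean
  -- dictionary: ν = a₁, M = M₁, K f = a₁⁻¹ · linearBoltzmannGain 1 f
  have hν : ∀ v, ν v = collisionFrequency 1 v := fun v => nu_eq v
  have hM : ∀ v, M v = maxwellianBeta 1 v := fun v => by
    show globalMaxwellian v = maxwellianBeta 1 v; rw [maxwellianBeta_one]
  have hK : ∀ v, K f v = (collisionFrequency 1 v)⁻¹ * linearBoltzmannGain 1 f v := fun v => by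
    show (ν v)⁻¹ * _ = _
    rw [hν v]
    simp only [linearBoltzmannGain_eq, gainIntegrand, maxwellianBeta_one]
    rfl
  have hνM : ∀ v, ν v * M v = collisionFrequency 1 v * maxwellianBeta 1 v := fun v => by rw [hν v, hM v]
  simp_rw [hK, hνM]
  simp_rw [hνM] at hint hmean
  -- finite energy of `f`
  have hfE : FiniteEnergy 1 f :=
    ⟨hf, hint.congr (Eventually.of_forall fun v => by simp only; ring)⟩
  set F : Lp ℝ 2 (energyMeasure (d := Fin 3) 1) := (hfE.memLp one_pos).toLp f with hFdef
  have hFe : ⟪F, e⟫_ℝ = 0 := by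
    rw [real_inner_comm, he, hFdef, inner_constOne_toLp_eq hd3 one_pos hfE]; exact hmean
  have hq := quarter F hFe
  -- `‖F‖² = ∫ f² a₁ M`
  rw [hFdef, norm_toLp_sq_eq hd3 one_pos hfE, ← hFdef] at hq
  -- `‖T F‖² = ∫ (K f)² a₁ M`
  have hTF : ‖T F‖ ^ 2 =
      ∫ v, ((collisionFrequency 1 v)⁻¹ * linearBoltzmannGain 1 f v) ^ 2 *
        (collisionFrequency 1 v * maxwellianBeta 1 v) := by
    rw [norm_sq_eq_integral_rep one_pos]
    refine integral_congr_ae ?_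
    have hcar : ∀ᵐ v : V3, linearBoltzmannGain 1 f v = carlemanGain 1 f v := by
      filter_upwards [ae_integrable_carlemanKernel_mul hd3 one_pos hfE.measurable hfE.integrable]
        with v hv
      exact linearBoltzmannGain_eq_carlemanGain hd3 one_pos hf v hv
    filter_upwards [HE f hfE, hcar] with v hv hv'
    rw [hT, hFdef, hv, hv']
    ring
  rw [hTF] at hq
  exact hq

/-- **`SpectralContractionR` holds** (crux stmt-AtomisticToContinuum-13913 of route InformationPercolationEngine):
subcritical χ²-contraction of the hard-sphere jump operator on measurable mean-zero `L²(π)`, with `c = 1/4`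
(`λ₂² ≤ 1/4 < 1/2`): the skeleton theorem applied to the six discharged stubs. [folklore] -/
theorem SpectralContractionR_proof : SpectralContractionR :=
  SpectralContractionR_of Holds.stub_partnerLaw Holds.stub_negType Holds.stub_fluxPairNonpos
    Holds.stub_coreBound Holds.stub_gainOpRep Holds.stub_normSqLeQuarter

end Summit.AtomisticToContinuum.HydrodynamicLimit.Cruxes.SpectralContractionR.SwapSymmetrisation

end
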